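/-
Copyright (c) 2026 the pub-hodgecm-mathlib formalisation cell (harness21).  Prover seat hodgecm-mathlib-F0P3-p01 (g31), «(D-RAM) FOUR-FRAME» road of crux H413, line LH4, MS ROAD A,
STAGE B ∕ B6₂: «GLUE SHELLS AT A GENERAL CORNER» — the predicate-free, corner-general twin of ★ p855870 (LH4-p10 (g2)).  2026-09-04.
-/
import Summits.HodgeConjecture.HodgeConjecture.Theorems.F0P3cDyRamDiagonalGlueShellCount        -- ★ p855870 (LH4-p10 (g2)) B6: `mem_glueSubgroup_iff`, `relIndex_ball_glueSubgroup`; brings ★ B5 (i)(ii), ★ B1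
import Summits.HodgeConjecture.HodgeConjecture.Theorems.F0P3cDyRamDiagonalGluedStabilityCorner   -- ★ p856176 (this seat): `mapGL_latt_hnf_glued_corner_eq_iff`
import HarnessLib

/-!
# Crux `H413`, MS ROAD A, STAGE B ∕ B6₂: «GLUE SHELLS AT A GENERAL CORNER» — on the glue foot the stable (R)-lattices form ONE additive coset, of index
# `q^{ρ+e} · q^{⌈(ρ+s)∕2⌉−⌈j∕2⌉}` over `𝔭^{2ρ+s+e}` (type 0: `e = 0`, ★ p855870; type 2: `e = 1`)

Cell `hodgecm-mathlib` (D-0151), FLOOR 0, crux item H413 = `stmt-HodgeConjecture-24833`; lane `--supports stmt-HodgeConjecture-24833 --as helper` (count-neutral).  THEOREMS ONLY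
(no `def`, no instance, no notation, no `sorry`).  LH4-p10 (g2) MEMO v2 §4 (GG) ∕ MEMO v2.1 §T2.3 «GLUE»: on the glued stratum `V = (1 0 0; x ϖ^ρ 0; xζ+y″ ϖ^ρζ ϖ^{2ρ+2t+e})`
(`|x| = |ζ| = 1`, `|y″| = |ϖ|^{2t}`) at the SPECIAL foot `n₁ = n₂ + 2t` in the glue regime `n₂ < 2ρ + e`, `ρ + e ≤ n₂`, `ρ ≤ n₃`, a point `y″` gives a `T`-STABLE lattice
satisfying the γ-free criterion (R) `∃ f = σf, |ζσy″ − σx·f| ≤ |ϖ|^{ρ+2t}` iff (S3) `|y″ − y₁| ≤ |ϖ|^j` (`y₁ = −((β−1)∕(α−1))·xζ`, `j = 2ρ + 2t + e − n₂`) and (R).  THIS FILE is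
★ p855870's `glue_solutionSet_eq_coset` with two changes: the corner is `2ρ + 2t + e` (any `e`; ★ p856176's corner congruences), and DUALISABILITY is replaced by the raw
criterion (R) — so the SAME theorem serves type 0 (compose with ★ B5 (i) `isDualisableLattice_latt_hnf_glued_iff`, `e = 0`) and type 2 (compose with LH4-p09 (g2)'s (i)₂
`isTypeTwoPolarisable_latt_hnf_glued_iff`, `e = 1`), and needs neither the wild trace bound nor `t ≥ 1`.
* **`glue_solutionSet_criterionR_eq_coset_corner`** — IF the glue unit `g = (β−1)∕(α−1)` is `F`-rational to relative depth, `∃ f₀ = σf₀, |g − f₀| ≤ |ϖ|^j`, then there is `y₀` with: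
  `(|y″| = |ϖ|^{2t} ∧ T·latt V = latt V ∧ (R)) ↔ y″ − y₀ ∈ W`, `W = θ⁻¹((𝒪_F ∩ 𝔭^j) + 𝔭^{ρ+2t})` (★ `mem_glueSubgroup_iff`, `θ = (ζ∕σx)·σ`).
* `relIndex_ball_glueSubgroup_corner` — `[W : 𝔭^{2ρ+2t+e}] = q^{ρ+e} · q^{⌈(ρ+2t)∕2⌉ − ⌈j∕2⌉}` (★ `relIndex_ball_glueSubgroup` at `(ρ+e, 2t−e)`; needs `e ≤ 2t`).
* the type-2 letters (`e = 1`, corner `2ρ+1+2t`): `glue_solutionSet_criterionR_eq_coset_typeTwo`, `relIndex_ball_glueSubgroup_typeTwo`.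
(The EMPTY case — no `f₀` — is ★ B0 `exists_fixed_near_glueUnit_iff`'s business at the assembler, exactly as in type 0.)
HONEST LABEL.  Count-neutral (`--supports`); the census laws (MS) stay PROVER TARGETS until the Stage B ∕ B9 assemblies land (type-2 heads under re-key per dealer WORD #21:
this brick is `n₂`-independent); `HC_CM` is proved only modulo the 7 printed citations (2 remaining named inputs: hLiu418 = `stmt-HodgeConjecture-24832`, h413 =
`stmt-HodgeConjecture-24833`) until rung 0 closes.

## References
* [Kottwitz1986BaseChangeUnits] R. Kottwitz, *Base change for unit elements of Hecke algebras*, Compositio Math. 60 (1986), §1 pp. 240–241 (fixed-lattice counting).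
* [Serre1979] J.-P. Serre, *Local Fields*, GTM 67 (1979), Ch. II §3 Prop. 5; Ch. I §6 Prop. 18 (residue counts, fixed subring of a ramified quadratic extension).
-/

set_option autoImplicit false

noncomputable section

namespace Summit.HodgeConjecture.HodgeConjecture.Cruxes.H413.F0P3cDyRamDiagonalGlueShellCountCorner

open WithZero
open Literature.NumberTheory.Automorphic Literature.NumberTheory.Automorphic.HermitianLattice
open Literature.NumberTheory.Automorphic.UnitaryLatticeTree
open Literature.NumberTheory.LocalFields.WildQuadraticDatum
open Summit.HodgeConjecture.HodgeConjecture.Cruxes.H413.F0P3cDyRamDiagonalTorusDefs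
open Summit.HodgeConjecture.HodgeConjecture.Cruxes.H413.F0P3cDyRamDiagonalGlueShellCount
open Summit.HodgeConjecture.HodgeConjecture.Cruxes.H413.F0P3cDyRamDiagonalGluedStabilityCorner
open scoped Valued WithZero Matrix MatrixGroups

variable {K : Type*} [Field K] [Valued K ℤᵐ⁰] {σ : K →+* K} {ϖ : K}

/-- **`[W : 𝔭^{2ρ+2t+e}] = q^{ρ+e} · q^{⌈(ρ+2t)∕2⌉ − ⌈j∕2⌉}`** for the glue subgroup `W = θ⁻¹((𝒪_F ∩ 𝔭^j) + 𝔭^{ρ+2t})` (`j ≤ ρ + 2t`, `e ≤ 2t`, `c = ζ∕σx` a unit): ★ p855870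
`relIndex_ball_glueSubgroup` at the shifted pair `(ρ + e, 2t − e)` (`2(ρ+e) + (2t−e) = 2ρ+2t+e`, `(ρ+e) + (2t−e) = ρ+2t`). [cite: Serre1979, Ch. II §3 Prop. 5; Ch. I §6 Prop. 18] -/
theorem relIndex_ball_glueSubgroup_corner {d : ℕ} (hσ : ∀ x, σ (σ x) = x) (hvσ : ∀ a, Valued.v (σ a) = Valued.v a)
    (hfix : ∀ x : K, σ x = x → x ≠ 0 → ∃ n : ℤ, Valued.v x = exp (2 * n)) (hϖ : Valued.v ϖ = exp (-1 : ℤ))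
    (hd : Valued.v (ϖ - σ ϖ) = Valued.v ϖ ^ d) [Finite 𝓀[K]] {c : K} (hc : Valued.v c = 1) {j ρ t e : ℕ} (hj : j ≤ ρ + 2 * t) (het : e ≤ 2 * t) :
    ((Valued.v : Valuation K ℤᵐ⁰).leAddSubgroup (exp (-((2 * ρ + 2 * t + e : ℕ) : ℤ)))).relIndex
        ((((σ.toAddMonoidHom - AddMonoidHom.id K).ker ⊓ (Valued.v : Valuation K ℤᵐ⁰).leAddSubgroup (exp (-(j : ℤ)))) ⊔
            (Valued.v : Valuation K ℤᵐ⁰).leAddSubgroup (exp (-((ρ + 2 * t : ℕ) : ℤ)))).comap ((AddMonoidHom.mulLeft c).comp σ.toAddMonoidHom)) =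
      Nat.card 𝓀[K] ^ (ρ + e) * Nat.card 𝓀[K] ^ ((ρ + 2 * t + 1) / 2 - (j + 1) / 2) := by
  have h := relIndex_ball_glueSubgroup hσ hvσ hfix hϖ hd hc (e := j) (ρ := ρ + e) (s := 2 * t - e) (by omega)
  rw [show 2 * (ρ + e) + (2 * t - e) = 2 * ρ + 2 * t + e by omega, show ρ + e + (2 * t - e) = ρ + 2 * t by omega] at h
  exact h

/-- **B6₂ · THE GLUE SOLUTION SET IS A COSET, general corner, predicate-free.**  Glued stratum at corner `2ρ + 2t + e` on the special foot: units `α, β` with `|β−1| = |ϖ|^{n₁}`,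
`|α−1| = |ϖ|^{n₂}`, `|β−α| = |ϖ|^{n₃}`, `n₁ = n₂ + 2t`, glue regime `n₂ < 2ρ + e`, `ρ + e ≤ n₂`, `ρ ≤ n₃`; `j := 2ρ + 2t + e − n₂`.  IF the glue unit `g = (β−1)∕(α−1)` is
`F`-rational to relative depth — `∃ f₀, σ f₀ = f₀ ∧ |g − f₀| ≤ |ϖ|^j` — then there is `y₀` such that for every `y″`:
`(|y″| = |ϖ|^{2t} ∧ T·latt V = latt V ∧ ∃ f = σf, |ζσy″ − σx·f| ≤ |ϖ|^{ρ+2t}) ↔ y″ − y₀ ∈ W` (`W` as in ★ `mem_glueSubgroup_iff` with `e := j`, `n := ρ + 2t`).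
Proof = ★ p855870's, with the stability read at corner `2ρ+2t+e` (★ p856176) and (R) carried raw. [cite: Kottwitz1986BaseChangeUnits, §1 pp. 240–241] [cite: Serre1979, Ch. I §6 Prop. 18] -/
theorem glue_solutionSet_criterionR_eq_coset_corner (hσ : ∀ a, σ (σ a) = a) (hvσ : ∀ a, Valued.v (σ a) = Valued.v a)
    (hϖ : Valued.v ϖ = exp (-1 : ℤ)) {α β : K} (hα : Valued.v α = 1) (hβ : Valued.v β = 1) (T : GL (Fin 3) K)
    (hT : (T : Matrix (Fin 3) (Fin 3) K) = Matrix.diagonal ![α, β, 1])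
    {n₁ n₂ n₃ : ℕ} (h₁ : Valued.v (β - 1) = Valued.v ϖ ^ n₁) (h₂ : Valued.v (α - 1) = Valued.v ϖ ^ n₂) (h₃ : Valued.v (β - α) = Valued.v ϖ ^ n₃)
    (ρ t e : ℕ) (hsg : n₁ = n₂ + 2 * t) (hglue : n₂ < 2 * ρ + e) (hρ₂ : ρ + e ≤ n₂) (hρ₃ : ρ ≤ n₃)
    {x ζ : K} (hx : Valued.v x = 1) (hζ : Valued.v ζ = 1)
    {f₀ : K} (hf₀ : σ f₀ = f₀) (hgf₀ : Valued.v ((β - 1) / (α - 1) - f₀) ≤ Valued.v ϖ ^ (2 * ρ + 2 * t + e - n₂)) :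
    ∃ y₀ : K, ∀ y'' : K, ∀ (V : GL (Fin 3) K),
      (V : Matrix (Fin 3) (Fin 3) K) = !![1, 0, 0; x, ϖ ^ ρ, 0; x * ζ + y'', ϖ ^ ρ * ζ, ϖ ^ (2 * ρ + 2 * t + e)] →
      ((Valued.v y'' = Valued.v ϖ ^ (2 * t) ∧ mapGL T (latt (V : Matrix (Fin 3) (Fin 3) K)) = latt (V : Matrix (Fin 3) (Fin 3) K) ∧
          ∃ f : K, σ f = f ∧ Valued.v (ζ * σ y'' - σ x * f) ≤ Valued.v ϖ ^ (ρ + 2 * t)) ↔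
        y'' - y₀ ∈ (((σ.toAddMonoidHom - AddMonoidHom.id K).ker ⊓ (Valued.v : Valuation K ℤᵐ⁰).leAddSubgroup (exp (-((2 * ρ + 2 * t + e - n₂ : ℕ) : ℤ)))) ⊔
          (Valued.v : Valuation K ℤᵐ⁰).leAddSubgroup (exp (-((ρ + 2 * t : ℕ) : ℤ)))).comap ((AddMonoidHom.mulLeft (ζ * (σ x)⁻¹)).comp σ.toAddMonoidHom)) := by
  -- notation
  set j : ℕ := 2 * ρ + 2 * t + e - n₂ with hj
  have heq : j + n₂ = 2 * ρ + 2 * t + e := by omega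
  have hen : j ≤ ρ + 2 * t := by omega
  have het : 2 * t < j := by omega
  have hvϖ : 0 < Valued.v ϖ := by rw [hϖ]; exact exp_pos
  have hϖ0 : ϖ ≠ 0 := (Valuation.ne_zero_iff _).1 hvϖ.ne'
  have hϖ1 : Valued.v ϖ < 1 := by rw [hϖ, ← exp_zero, exp_lt_exp]; norm_num
  have hpow_anti : ∀ {m n : ℕ}, m ≤ n → Valued.v ϖ ^ n ≤ Valued.v ϖ ^ m := fun h => pow_le_pow_right_of_le_one' hϖ1.le h
  set A : K := α - 1 with hA
  set B : K := β - 1 with hB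
  have hA0 : A ≠ 0 := (Valuation.ne_zero_iff _).1 (by rw [h₂]; exact pow_ne_zero _ hvϖ.ne')
  have hvA : 0 < Valued.v A := (Valuation.pos_iff _).2 hA0
  set g : K := B / A with hg
  have hvg : Valued.v g = Valued.v ϖ ^ (2 * t) := by
    rw [hg, map_div₀, h₁, h₂, hsg, pow_add, mul_div_cancel_left₀ _ (pow_ne_zero _ hvϖ.ne')]
  have hσx0 : σ x ≠ 0 := fun h => by rw [← hvσ x, h, map_zero] at hx; exact zero_ne_one hx
  have hvσx : Valued.v (σ x) = 1 := by rw [hvσ, hx]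
  have hζ0 : ζ ≠ 0 := (Valuation.ne_zero_iff _).1 (by rw [hζ]; exact one_ne_zero)
  set Nζ : K := ζ * σ ζ with hNζ
  have hσNζ : σ Nζ = Nζ := by rw [hNζ, map_mul, hσ, mul_comm]
  have hvNζ : Valued.v Nζ = 1 := by rw [hNζ, map_mul, hvσ, hζ, one_mul]
  -- `y₁ = −g·x·ζ`, `θ(y₁) = −σ(g)·Nζ = φ₁ + ε₂` with `φ₁ = −f₀·Nζ ∈ F`, `|ε₂| ≤ |ϖ|^j`
  set y₁ : K := -(g * x * ζ) with hy₁
  set φ₁ : K := -(f₀ * Nζ) with hφ₁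
  set ε₂ : K := -(σ (g - f₀) * Nζ) with hε₂
  have hσφ₁ : σ φ₁ = φ₁ := by rw [hφ₁, map_neg, map_mul, hf₀, hσNζ]
  have hvε₂ : Valued.v ε₂ ≤ Valued.v ϖ ^ j := by
    rw [hε₂, Valuation.map_neg, map_mul, hvσ, hvNζ, mul_one]; exact hgf₀
  have hθy₁ : ζ * (σ x)⁻¹ * σ y₁ = φ₁ + ε₂ := by
    rw [hy₁, hφ₁, hε₂, hNζ, map_neg, map_mul, map_mul, map_sub, hf₀]; field_simp; ring
  -- `δ₂` with `θ(δ₂) = ε₂`, `|δ₂| = |ε₂|`; `y₀ := y₁ − δ₂`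
  set δ₂ : K := σ (σ x * ζ⁻¹ * ε₂) with hδ₂
  have hθδ₂ : ζ * (σ x)⁻¹ * σ δ₂ = ε₂ := by rw [hδ₂, hσ]; field_simp
  have hvδ₂ : Valued.v δ₂ ≤ Valued.v ϖ ^ j := by
    rw [hδ₂, hvσ, map_mul, map_mul, hvσx, map_inv₀, hζ, inv_one, one_mul, one_mul]; exact hvε₂
  refine ⟨y₁ - δ₂, fun y'' V hV => ?_⟩
  have hθy₀ : ζ * (σ x)⁻¹ * σ (y₁ - δ₂) = φ₁ := by rw [map_sub, mul_sub, hθy₁, hθδ₂, add_sub_cancel_right]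
  -- the key identity `B·xζ + A·y″ = A·(y″ − y₁)`
  have hkey : B * x * ζ + A * y'' = A * (y'' - y₁) := by rw [hy₁, hg]; field_simp; ring
  have hvy₁ : Valued.v y₁ = Valued.v ϖ ^ (2 * t) := by rw [hy₁, Valuation.map_neg, map_mul, map_mul, hvg, hx, hζ, mul_one, mul_one]
  rw [mem_glueSubgroup_iff hσ hvσ hϖ hx hζ hen]
  constructor
  · rintro ⟨hvy, hstab, ⟨f, hf, hR⟩⟩
    obtain ⟨-, -, h3⟩ := (mapGL_latt_hnf_glued_corner_eq_iff hϖ0 hα hβ T hT ρ (2 * t) e x ζ y'' V hV).1 hstab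
    refine ⟨?_, f - φ₁, by rw [map_sub, hf, hσφ₁], ?_⟩
    · -- `|y″ − y₀| ≤ max(|y″ − y₁|, |δ₂|)`, `|A|·|y″ − y₁| ≤ |ϖ|^{2ρ+2t+e}`
      have h1 : Valued.v (y'' - y₁) ≤ Valued.v ϖ ^ j := by
        rw [hkey, map_mul, h₂] at h3
        rw [← heq, pow_add, mul_comm] at h3
        exact le_of_mul_le_mul_right h3 (pow_pos hvϖ _)
      have e1 : y'' - (y₁ - δ₂) = (y'' - y₁) + δ₂ := by ring
      rw [e1]
      exact (Valuation.map_add _ _ _).trans (max_le h1 hvδ₂)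
    · have e2 : ζ * σ (y'' - (y₁ - δ₂)) - σ x * (f - φ₁) = (ζ * σ y'' - σ x * f) - σ x * (ζ * (σ x)⁻¹ * σ (y₁ - δ₂) - φ₁) := by
        simp only [map_sub]; field_simp; ring
      rw [e2, hθy₀, sub_self, mul_zero, sub_zero]; exact hR
  · rintro ⟨h1, f', hf', hR'⟩
    -- `|y″ − y₁| ≤ |ϖ|^j < |ϖ|^{2t} = |y₁|`
    have hy1 : Valued.v (y'' - y₁) ≤ Valued.v ϖ ^ j := by
      have e1 : y'' - y₁ = (y'' - (y₁ - δ₂)) + -δ₂ := by ring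
      rw [e1]
      exact (Valuation.map_add _ _ _).trans (max_le h1 (by rw [Valuation.map_neg]; exact hvδ₂))
    have hvy : Valued.v y'' = Valued.v ϖ ^ (2 * t) := by
      have e1 : y'' = y₁ + (y'' - y₁) := by ring
      rw [e1, Valuation.map_add_eq_of_lt_left, hvy₁]
      rw [hvy₁]; exact hy1.trans_lt (pow_lt_pow_right_of_lt_one₀ hvϖ hϖ1 het)
    -- (R) for `y″` with `f := f′ + φ₁`
    have hR : Valued.v (ζ * σ y'' - σ x * (f' + φ₁)) ≤ Valued.v ϖ ^ (ρ + 2 * t) := by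
      have e2 : ζ * σ y'' - σ x * (f' + φ₁) = (ζ * σ (y'' - (y₁ - δ₂)) - σ x * f') + σ x * (ζ * (σ x)⁻¹ * σ (y₁ - δ₂) - φ₁) := by
        simp only [map_sub]; field_simp; ring
      rw [e2, hθy₀, sub_self, mul_zero, add_zero]; exact hR'
    refine ⟨hvy, ?_, f' + φ₁, by rw [map_add, hf', hσφ₁], hR⟩
    -- stability at corner `2ρ+2t+e`: (S2) `ρ ≤ n₃`, (S1) `ρ + e ≤ n₂`, (S3) `|A|·|y″−y₁| ≤ |ϖ|^{n₂+j}`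
    refine (mapGL_latt_hnf_glued_corner_eq_iff hϖ0 hα hβ T hT ρ (2 * t) e x ζ y'' V hV).2 ⟨?_, ?_, ?_⟩
    · rw [map_mul, hx, mul_one, h₃]; exact hpow_anti hρ₃
    · rw [map_mul, hζ, mul_one, h₁]; exact hpow_anti (by omega)
    · rw [hkey, map_mul, h₂, ← heq, pow_add, mul_comm]
      exact mul_le_mul_left hy1 _

/-- **TYPE 2** (corner `2ρ+1+2t`, MEMO v2.1 §T2.3 «GLUE»: `n₂ < 2ρ+1`, `ρ+1 ≤ n₂`, `j = 2ρ+1+2t−n₂`): the glue solution set for the (R)-stable points is ONE coset of `W`.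
[cite: Kottwitz1986BaseChangeUnits, §1 pp. 240–241] [cite: Serre1979, Ch. I §6 Prop. 18] -/
theorem glue_solutionSet_criterionR_eq_coset_typeTwo (hσ : ∀ a, σ (σ a) = a) (hvσ : ∀ a, Valued.v (σ a) = Valued.v a)
    (hϖ : Valued.v ϖ = exp (-1 : ℤ)) {α β : K} (hα : Valued.v α = 1) (hβ : Valued.v β = 1) (T : GL (Fin 3) K)
    (hT : (T : Matrix (Fin 3) (Fin 3) K) = Matrix.diagonal ![α, β, 1])
    {n₁ n₂ n₃ : ℕ} (h₁ : Valued.v (β - 1) = Valued.v ϖ ^ n₁) (h₂ : Valued.v (α - 1) = Valued.v ϖ ^ n₂) (h₃ : Valued.v (β - α) = Valued.v ϖ ^ n₃)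
    (ρ t : ℕ) (hsg : n₁ = n₂ + 2 * t) (hglue : n₂ < 2 * ρ + 1) (hρ₂ : ρ + 1 ≤ n₂) (hρ₃ : ρ ≤ n₃)
    {x ζ : K} (hx : Valued.v x = 1) (hζ : Valued.v ζ = 1)
    {f₀ : K} (hf₀ : σ f₀ = f₀) (hgf₀ : Valued.v ((β - 1) / (α - 1) - f₀) ≤ Valued.v ϖ ^ (2 * ρ + 1 + 2 * t - n₂)) :
    ∃ y₀ : K, ∀ y'' : K, ∀ (V : GL (Fin 3) K),
      (V : Matrix (Fin 3) (Fin 3) K) = !![1, 0, 0; x, ϖ ^ ρ, 0; x * ζ + y'', ϖ ^ ρ * ζ, ϖ ^ (2 * ρ + 1 + 2 * t)] →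
      ((Valued.v y'' = Valued.v ϖ ^ (2 * t) ∧ mapGL T (latt (V : Matrix (Fin 3) (Fin 3) K)) = latt (V : Matrix (Fin 3) (Fin 3) K) ∧
          ∃ f : K, σ f = f ∧ Valued.v (ζ * σ y'' - σ x * f) ≤ Valued.v ϖ ^ (ρ + 2 * t)) ↔
        y'' - y₀ ∈ (((σ.toAddMonoidHom - AddMonoidHom.id K).ker ⊓ (Valued.v : Valuation K ℤᵐ⁰).leAddSubgroup (exp (-((2 * ρ + 1 + 2 * t - n₂ : ℕ) : ℤ)))) ⊔
          (Valued.v : Valuation K ℤᵐ⁰).leAddSubgroup (exp (-((ρ + 2 * t : ℕ) : ℤ)))).comap ((AddMonoidHom.mulLeft (ζ * (σ x)⁻¹)).comp σ.toAddMonoidHom)) := by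
  have hj : 2 * ρ + 2 * t + 1 - n₂ = 2 * ρ + 1 + 2 * t - n₂ := by omega
  obtain ⟨y₀, h⟩ := glue_solutionSet_criterionR_eq_coset_corner hσ hvσ hϖ hα hβ T hT h₁ h₂ h₃ ρ t 1 hsg (by omega) hρ₂ hρ₃ hx hζ hf₀ (by rw [hj]; exact hgf₀)
  refine ⟨y₀, fun y'' V hV => ?_⟩
  have hV1 : (V : Matrix (Fin 3) (Fin 3) K) = !![1, 0, 0; x, ϖ ^ ρ, 0; x * ζ + y'', ϖ ^ ρ * ζ, ϖ ^ (2 * ρ + 2 * t + 1)] := by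
    rw [hV, show 2 * ρ + 1 + 2 * t = 2 * ρ + 2 * t + 1 by ring]
  rw [← hj]
  exact h y'' V hV1

/-- **TYPE 2, THE INDEX**: `[W : 𝔭^{2ρ+1+2t}] = q^{ρ+1} · q^{⌈(ρ+2t)∕2⌉ − ⌈j∕2⌉}` (`j ≤ ρ + 2t`, `1 ≤ t`). [cite: Serre1979, Ch. II §3 Prop. 5; Ch. I §6 Prop. 18] -/
theorem relIndex_ball_glueSubgroup_typeTwo {d : ℕ} (hσ : ∀ x, σ (σ x) = x) (hvσ : ∀ a, Valued.v (σ a) = Valued.v a)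
    (hfix : ∀ x : K, σ x = x → x ≠ 0 → ∃ n : ℤ, Valued.v x = exp (2 * n)) (hϖ : Valued.v ϖ = exp (-1 : ℤ))
    (hd : Valued.v (ϖ - σ ϖ) = Valued.v ϖ ^ d) [Finite 𝓀[K]] {c : K} (hc : Valued.v c = 1) {j ρ t : ℕ} (hj : j ≤ ρ + 2 * t) (ht : 1 ≤ t) :
    ((Valued.v : Valuation K ℤᵐ⁰).leAddSubgroup (exp (-((2 * ρ + 1 + 2 * t : ℕ) : ℤ)))).relIndex
        ((((σ.toAddMonoidHom - AddMonoidHom.id K).ker ⊓ (Valued.v : Valuation K ℤᵐ⁰).leAddSubgroup (exp (-(j : ℤ)))) ⊔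
            (Valued.v : Valuation K ℤᵐ⁰).leAddSubgroup (exp (-((ρ + 2 * t : ℕ) : ℤ)))).comap ((AddMonoidHom.mulLeft c).comp σ.toAddMonoidHom)) =
      Nat.card 𝓀[K] ^ (ρ + 1) * Nat.card 𝓀[K] ^ ((ρ + 2 * t + 1) / 2 - (j + 1) / 2) := by
  rw [show 2 * ρ + 1 + 2 * t = 2 * ρ + 2 * t + 1 by ring]
  exact relIndex_ball_glueSubgroup_corner hσ hvσ hfix hϖ hd hc hj (by omega)

end Summit.HodgeConjecture.HodgeConjecture.Cruxes.H413.F0P3cDyRamDiagonalGlueShellCountCorner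

end
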